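import Summits.AtomisticToContinuum.FouriersLaw.Theses.CoercivePulse
import Summits.AtomisticToContinuum.FouriersLaw.Theorems.HeatVarianceCalculus.Negative.LoadBearing
import Literature.MathematicalPhysics.KineticTheory.InfiniteChainObservables
import Literature.MathematicalPhysics.KineticTheory.InfiniteChainGibbsExistenceShift
import Literature.MathematicalPhysics.KineticTheory.InfiniteChainShiftInvariantUniqueness
import Literature.MathematicalPhysics.KineticTheory.InfiniteChainAbelWitness
import HarnessLib

/-!
# Disproof of `PulseCalculus` (crux stmt-AtomisticToContinuum-15385, route CoercivePulse) — findings

**STATUS (cdisprove cycle 1, 2026-08-17): NO KILL IS POSSIBLE — the crux is a THEOREM BY NAME in the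
tree: `Summit.AtomisticToContinuum.FouriersLaw.Theorems.PulseCalculus.CanonicalReduction.pulseCalculus_proof`
(`Theorems/CoercivePulsePulseCalculus.lean`, p166581, item closed `proved` 2026-08-17T14:35:59Z; stubs of
line `Sketch` landed as p166017 `stub_covWindowMajorant`, p166122 `stub_pulseCurrentAsCovariance`,
p166075 `stub_helfandLocal`). So every counterexample search below necessarily fails; what is recorded
here, as Lean, is the LOAD-BEARING ANALYSIS of its guard (which hypothesis does the work, which are idle)
for the planners of the sibling pulse cruxes `LinearSpread` / `LinearCeiling` / `AbelRegularity` (same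
guard Γ verbatim) and of the routes CurrentTiltQuench / CageBudgetFekete / HoelderEscapeProfile.**
Landed negatives: p166889 `Theorems/PulseCalculus/Negative/LoadBearing.lean`
(`exists_pseudoDynamics_pulse`, `pulseCalculus_false_without_carrierAE`,
`pulseCalculus_false_without_preservesMeasure`), p166905
`Theorems/PulseCalculus/Negative/HelfandLocalWithoutSummableS.lean` (`not_summable_sq_mul`,
`helfandLocal_false_without_summableS`).

The crux (`Theses.CoercivePulse.PulseCalculus`): under the guard Γ — `pinnedChain ω₂ lam β γ`
(`ω₂, lam, β > 0`, any `γ`), `T > 0`, `μ` a shift- and momentum-reversal-invariant DLR state at `T`,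
`D : InfiniteChainDynamics` with `D.PreservesMeasure μ` and a.e. shift-covariant flow, `h` = split-bond
site energy, `S(x,t) = Cov(h_0, h_x∘φ_t)`, `M = Σ_x x²S`, `C_T = D.currentCorrelation μ` — the five
conjuncts (1) `∀ t, HasAbsConvergentCorrelation`; (2) `∀ ν>0, e^{-νt}C_T ∈ L¹(0,∞)`;
(3) `∀ t, Σ_x(1+x²)|S(x,t)| < ∞`; (4) `M` continuous; (5) `∀ ν>0`, `e^{-νt}(M-M(0)) ∈ L¹(0,∞)` and
`∫₀^∞e^{-νt}C_T = (ν²/2)∫₀^∞e^{-νt}(M(t)-M(0))`.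

## Why it resists (read this first)

* NO JUNK STATE: the shift-invariant DLR state of `pinnedChain` at `T > 0` EXISTS and is UNIQUE
  (`exists_isChainGibbsMeasure_shiftInvariant_superstable_pinnedChain`,
  `eq_of_isChainGibbsMeasure_of_isShiftInvariant_pinnedChain`), is superstable and `R`-invariant; Dirac /
  zero-temperature / product junk states are not DLR (`not_isChainGibbsMeasure_dirac`,
  `isChainGibbsMeasure_pinnedChain_temp_pos`). So `∀ μ` ranges over ONE measure per `T`.
* NO JUNK DYNAMICS UNDER THE GUARD: `PreservesMeasure` = (carrier has full measure) ∧ (each `φ_t`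
  measure preserving); on the carrier the orbits SOLVE the equations and are unique, and the landed
  rigidity theorem (`AbelSpreadCeiling.RegularityCollapse.stub_canonicalTwin`, via
  `OscillatorChain.ae_forall_flow_mem_bmGood_pinnedChain`) makes every guarded `D` agree `μ`-a.e., at all
  times, with the canonical Buttà–Marchioro dynamics. So `∀ D` ranges over ONE flow up to null sets, and
  `S`, `M`, `C_T` are those of the physical chain. The only junk inhabitant of `InfiniteChainDynamics`
  (empty carrier, §1) is excluded by exactly one clause, `∀ᵐ σ ∂μ, σ ∈ D.carrier` — §2 proves that
  clause is LOAD-BEARING (drop it and the crux is false).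
* CONVENTIONS CHECKED (a mis-matched energy/current pair would make (5) false for the true dynamics):
  the route's `h` is literally `OscillatorChain.energyDensityZ` (split-bond), whose conservation law
  `ḣ_x = j_{x-1} - j_x` holds with `bondCurrentZ = -½(p_x+p_{x+1})V'(q_{x+1}-q_x)` — the current inside
  `currentCorrelation` (tree: `IsSolution.hasDerivAt_energyDensityZ`). Hand check: `M' = Σ(2x+1)F`,
  `F(x,t) = Cov(h_0, j_x∘φ_t)`, `∂_tF = G(x) - G(x+1)` (stationarity + `ḣ_0 = j_{-1} - j_0` + shift),
  `M'' = Σ_x G(x)[(2x+1)-(2x-1)] = 2C_T`, `M'(0) = Σ(2x+1)Cov(h_0,j_x) = 0` (`h` even, `j` odd under `R`);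
  Laplace: `∫e^{-νt}·2∫₀ᵗ(t-u)C(u)du dt = (2/ν²)Ĉ(ν)`. The factor `ν²/2` and the sign are right.
* REDUCTION TO LANDED MATERIAL: (1), (2) and `Ĉ(ν) = (ν²/2)·L[V_T](ν)` with `V_T(t) = 2∫₀ᵗ(t-s)C_T`
  are the PROVED sibling crux `CageBudgetFekete.HeatVarianceCalculus` (identical guard); so
  PulseCalculus ⟸ HeatVarianceCalculus ∧ (3) ∧ (4) ∧ [local Helfand identity `M(t)-M(0) = V_T(t)`, t>0],
  which is exactly the composition `Lines/Sketch.lean :: PulseCalculus_of` (kernel-checked). Nothing in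
  (3)/(4)/local-Helfand is refutable: at `lam = β = 0` (harmonic, excluded anyway) all three HOLD
  (Bessel light cone), and for the quartic chain the weighted `L²` light cone + clustering are landed
  (`FibreCalculusSketch.stub_polynomialHorizonCone`, `stub_weightedClusteringTransfer`).

## Findings (sections below)

* §1 `pseudoDynamics P` — the carrier-free inhabitant (`carrier = ∅`, `φ₀ = id`, `φ_t = R` for `t ≠ 0`):
  measure preserving for `R`-invariant `μ`, shift-commuting EVERYWHERE; its pulse is STATIC
  (`pseudo_pulse_static`: `h∘R = h`, so `S(x,t) = S(x,0)`, `M ≡ M(0)`), while `C(t) = -C₀` for `t ≠ 0`.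
* §2 LOAD-BEARING: `PulseCalculusWithoutCarrierAE` (the crux with `PreservesMeasure` weakened to
  `∀ t, MeasurePreserving (φ_t)`) is FALSE — `pulseCalculus_false_without_carrierAE`: clause (5) at
  `ν = 1` reads `-C₀ = (1/2)·∫e^{-t}·0 = 0`, contradicting `C₀ > 0` (`static_sum_pos`, landed). Corollary
  `pulseCalculus_false_without_preservesMeasure`. Sanity `pulseCalculus_of_withoutCarrierAE` (the
  weakening implies the crux). READING FOR PROVERS: the carrier clause is the only hypothesis tying `φ_t`
  to the equations of motion; the line uses it once (rigidity / canonical twin). Note the junk passes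
  (3) and (4) (static clustering; `M` constant) — the Helfand identity (5b), not regularity, is what
  detects a non-Hamiltonian flow.
* §3 IDLE hypotheses (derivable from the others; information, not refutations): `hRefl`
  (`reversal_derivable`), `0 < T` (`temp_pos_derivable`: no DLR state at `T ≤ 0`), `γ` (not read by
  the infinite chain), a.e. shift covariance (holds for the canonical twin; transported by rigidity).
* §4 LINE `Sketch` (lead prover-line-stmt-AtomisticToContinuum-15385-0; ALL THREE STUBS LANDED, crux
  closed): S1/S2 are re-exports of landed steps; S3 `stub_helfandLocal` is TRUE pure real analysis
  (landed p166075: Fubini on `(0,t] × ℤ` dominated by `t²Σx²(F(x±1)+2F(x))`, then `Σ_x x²ΔG = 2Σ_xG`).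
  Its hypothesis (iii) `Σ(1+x²)|S(·,t)| < ∞` is load-bearing THROUGH JUNK `tsum`:
  `helfandLocal_false_without_summableS` (G = δ₀ constant in time, `S(x,0) = 1`, `S(x,t) = 1 + t²ΔG/2`:
  both `x²`-sums diverge, junk `0 - 0 = 0 ≠ 1 = 2∫₀¹(1-u)·1`). No stub is mis-stated; joint
  sufficiency is kernel-checked (`PulseCalculus_of`).
* §5 Strengthenings NOT refutable here (do not re-run): `ν = 0` in (2)/(5) = Green–Kubo finiteness
  (open crux elsewhere); `sup_t Σ(1+x²)|S(·,t)| < ∞` ⟺ bounded `M` (insulator; open, = ¬LinearSpread);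
  exponential spatial moments of `S(·,t)` (plausible, super-exponential Gibbs cost of fast fronts). No
  finite/decidable instance exists (infinite-volume objects only): no `decide`/compute search applies.
-/

noncomputable section

namespace Summit.AtomisticToContinuum.FouriersLaw.Cruxes.PulseCalculus.Disproof

open MeasureTheory Filter Topology Set
open Literature.MathematicalPhysics.KineticTheory.HeatConduction
open Summit.AtomisticToContinuum.FouriersLaw.Theorems.HeatVarianceCalculus.Negative
  (static_sum_pos map_momentumReversalZ_eq)

/-! ## §1 The carrier-free pseudo-dynamics and its static pulse -/

/-- The junk inhabitant of `InfiniteChainDynamics P`: empty carrier (so `mapsTo`, `flow_zero`,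
`isSolution`, `unique` hold vacuously), `φ₀ = id`, `φ_t = R` (momentum reversal) for `t ≠ 0`.
[folklore] -/
def pseudoDynamics (P : OscillatorChain) : InfiniteChainDynamics P where
  carrier := ∅
  flow t σ := if t = 0 then σ else momentumReversalZ σ
  mapsTo _ σ h := absurd h (Set.notMem_empty σ)
  flow_zero σ h := absurd h (Set.notMem_empty σ)
  isSolution σ h := absurd h (Set.notMem_empty σ)
  unique _ hγ _ t := absurd (hγ t) (Set.notMem_empty _)

variable (P : OscillatorChain)

/-- `φ₀ = id`. [folklore] -/
theorem pseudo_flow_zero : (pseudoDynamics P).flow 0 = id := by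
  funext σ; simp [pseudoDynamics]

/-- `φ_t = R` for `t ≠ 0`. [folklore] -/
theorem pseudo_flow_ne {t : ℝ} (ht : t ≠ 0) : (pseudoDynamics P).flow t = momentumReversalZ := by
  funext σ; simp [pseudoDynamics, ht]

/-- Every `φ_t` of the pseudo-dynamics preserves an `R`-invariant measure. [folklore] -/
theorem pseudo_measurePreserving {μ : Measure ChainConfig} (hR : μ.map momentumReversalZ = μ)
    (t : ℝ) : MeasurePreserving ((pseudoDynamics P).flow t) μ μ := by
  by_cases ht : t = 0
  · subst ht; rw [pseudo_flow_zero]; exact MeasurePreserving.id μ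
  · rw [pseudo_flow_ne P ht]; exact ⟨momentumReversalZ.measurable, hR⟩

/-- The pseudo-flow commutes with the shift everywhere. [folklore] -/
theorem pseudo_shift_comm (t : ℝ) (σ : ChainConfig) :
    (pseudoDynamics P).flow t (shift σ) = shift ((pseudoDynamics P).flow t σ) := by
  by_cases ht : t = 0
  · subst ht; simp [pseudo_flow_zero]
  · simp only [pseudo_flow_ne P ht]; exact (shift_momentumReversalZ σ).symm

/-- `C(t) = -C₀` for `t ≠ 0` (the bond current is odd under `R`). [folklore] -/
theorem pseudo_currentCorrelation_ne (μ : Measure ChainConfig) {t : ℝ} (ht : t ≠ 0) :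
    (pseudoDynamics P).currentCorrelation μ t =
      -∑' x : ℤ, ∫ σ, P.bondCurrentZ σ 0 * P.bondCurrentZ σ x ∂μ := by
  simp only [InfiniteChainDynamics.currentCorrelation, pseudo_flow_ne P ht,
    bondCurrentZ_momentumReversalZ, mul_neg, integral_neg, tsum_neg]

/-- **The pulse of the pseudo-dynamics is static**: for any site-energy functional `h` even under
momentum reversal, `S(x,t) = ∫ (h₀ - c)(h_x ∘ φ_t - c) dμ` does not depend on `t`. [folklore] -/
theorem pseudo_pulse_static (μ : Measure ChainConfig) {h : ChainConfig → ℤ → ℝ}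
    (hh : ∀ σ x, h (momentumReversalZ σ) x = h σ x) (c : ℝ) (x : ℤ) (t : ℝ) :
    ∫ σ, (h σ 0 - c) * (h ((pseudoDynamics P).flow t σ) x - c) ∂μ =
      ∫ σ, (h σ 0 - c) * (h σ x - c) ∂μ := by
  by_cases ht : t = 0
  · subst ht; simp [pseudo_flow_zero]
  · rw [pseudo_flow_ne P ht]; simp only [hh]

/-- The split-bond site energy is even under momentum reversal. [folklore] -/
theorem splitBond_even (σ : ChainConfig) (x : ℤ) :
    (fun (σ : ChainConfig) (x : ℤ) => (σ x).2 ^ 2 / 2 + P.U (σ x).1 +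
        (P.V ((σ (x + 1)).1 - (σ x).1) + P.V ((σ x).1 - (σ (x - 1)).1)) / 2) (momentumReversalZ σ) x =
      (fun (σ : ChainConfig) (x : ℤ) => (σ x).2 ^ 2 / 2 + P.U (σ x).1 +
        (P.V ((σ (x + 1)).1 - (σ x).1) + P.V ((σ x).1 - (σ (x - 1)).1)) / 2) σ x := by
  simp

/-! ## §2 Load-bearing analysis: the carrier clause of `PreservesMeasure` -/

/-- `PulseCalculus` with `D.PreservesMeasure μ` (= `(∀ᵐ σ ∂μ, σ ∈ D.carrier) ∧
∀ t, MeasurePreserving (D.flow t) μ μ`) WEAKENED to its second clause only. [folklore] -/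
def PulseCalculusWithoutCarrierAE : Prop :=
  ∀ ω₂ lam β γ : ℝ, 0 < ω₂ → 0 < lam → 0 < β → ∀ T : ℝ, 0 < T → ∀ μ : Measure ChainConfig,
    (pinnedChain ω₂ lam β γ).IsChainGibbsMeasure T μ → IsShiftInvariant μ →
    μ.map (fun σ : ChainConfig => fun x : ℤ => ((σ x).1, -(σ x).2)) = μ →
    ∀ D : InfiniteChainDynamics (pinnedChain ω₂ lam β γ),
      (∀ t : ℝ, MeasurePreserving (D.flow t) μ μ) →
      (∀ t : ℝ, ∀ᵐ σ ∂μ, D.flow t (shift σ) = shift (D.flow t σ)) →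
      ∀ h : ChainConfig → ℤ → ℝ,
        h = (fun (σ : ChainConfig) (x : ℤ) => (σ x).2 ^ 2 / 2 + (pinnedChain ω₂ lam β γ).U (σ x).1 +
          ((pinnedChain ω₂ lam β γ).V ((σ (x + 1)).1 - (σ x).1) +
            (pinnedChain ω₂ lam β γ).V ((σ x).1 - (σ (x - 1)).1)) / 2) →
      ∀ S : ℤ → ℝ → ℝ,
        S = (fun (x : ℤ) (t : ℝ) =>
          ∫ σ, (h σ 0 - ∫ σ', h σ' 0 ∂μ) * (h (D.flow t σ) x - ∫ σ', h σ' 0 ∂μ) ∂μ) →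
      (∀ t : ℝ, D.HasAbsConvergentCorrelation μ t) ∧
      (∀ ν : ℝ, 0 < ν → IntegrableOn
        (fun t : ℝ => Real.exp (-(ν * t)) * D.currentCorrelation μ t) (Set.Ioi 0)) ∧
      (∀ t : ℝ, Summable (fun x : ℤ => (1 + (x : ℝ) ^ 2) * |S x t|)) ∧
      Continuous (fun t : ℝ => ∑' x : ℤ, (x : ℝ) ^ 2 * S x t) ∧
      (∀ ν : ℝ, 0 < ν →
        IntegrableOn (fun t : ℝ => Real.exp (-(ν * t)) *
          ((∑' x : ℤ, (x : ℝ) ^ 2 * S x t) - (∑' x : ℤ, (x : ℝ) ^ 2 * S x 0))) (Set.Ioi 0) ∧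
        ∫ t in Set.Ioi (0:ℝ), Real.exp (-(ν * t)) * D.currentCorrelation μ t =
          ν ^ 2 / 2 * ∫ t in Set.Ioi (0:ℝ), Real.exp (-(ν * t)) *
            ((∑' x : ℤ, (x : ℝ) ^ 2 * S x t) - (∑' x : ℤ, (x : ℝ) ^ 2 * S x 0)))

/-- `PulseCalculus` with the hypothesis `D.PreservesMeasure μ` DROPPED. [folklore] -/
def PulseCalculusWithoutPreservesMeasure : Prop :=
  ∀ ω₂ lam β γ : ℝ, 0 < ω₂ → 0 < lam → 0 < β → ∀ T : ℝ, 0 < T → ∀ μ : Measure ChainConfig,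
    (pinnedChain ω₂ lam β γ).IsChainGibbsMeasure T μ → IsShiftInvariant μ →
    μ.map (fun σ : ChainConfig => fun x : ℤ => ((σ x).1, -(σ x).2)) = μ →
    ∀ D : InfiniteChainDynamics (pinnedChain ω₂ lam β γ),
      (∀ t : ℝ, ∀ᵐ σ ∂μ, D.flow t (shift σ) = shift (D.flow t σ)) →
      ∀ h : ChainConfig → ℤ → ℝ,
        h = (fun (σ : ChainConfig) (x : ℤ) => (σ x).2 ^ 2 / 2 + (pinnedChain ω₂ lam β γ).U (σ x).1 +
          ((pinnedChain ω₂ lam β γ).V ((σ (x + 1)).1 - (σ x).1) +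
            (pinnedChain ω₂ lam β γ).V ((σ x).1 - (σ (x - 1)).1)) / 2) →
      ∀ S : ℤ → ℝ → ℝ,
        S = (fun (x : ℤ) (t : ℝ) =>
          ∫ σ, (h σ 0 - ∫ σ', h σ' 0 ∂μ) * (h (D.flow t σ) x - ∫ σ', h σ' 0 ∂μ) ∂μ) →
      (∀ t : ℝ, D.HasAbsConvergentCorrelation μ t) ∧
      (∀ ν : ℝ, 0 < ν → IntegrableOn
        (fun t : ℝ => Real.exp (-(ν * t)) * D.currentCorrelation μ t) (Set.Ioi 0)) ∧
      (∀ t : ℝ, Summable (fun x : ℤ => (1 + (x : ℝ) ^ 2) * |S x t|)) ∧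
      Continuous (fun t : ℝ => ∑' x : ℤ, (x : ℝ) ^ 2 * S x t) ∧
      (∀ ν : ℝ, 0 < ν →
        IntegrableOn (fun t : ℝ => Real.exp (-(ν * t)) *
          ((∑' x : ℤ, (x : ℝ) ^ 2 * S x t) - (∑' x : ℤ, (x : ℝ) ^ 2 * S x 0))) (Set.Ioi 0) ∧
        ∫ t in Set.Ioi (0:ℝ), Real.exp (-(ν * t)) * D.currentCorrelation μ t =
          ν ^ 2 / 2 * ∫ t in Set.Ioi (0:ℝ), Real.exp (-(ν * t)) *
            ((∑' x : ℤ, (x : ℝ) ^ 2 * S x t) - (∑' x : ℤ, (x : ℝ) ^ 2 * S x 0)))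

/-- Sanity: the weakened statement implies the crux (so its falsity speaks about the crux's guard, not
about a different statement). [folklore] -/
theorem pulseCalculus_of_withoutCarrierAE (h : PulseCalculusWithoutCarrierAE) :
    Theses.CoercivePulse.PulseCalculus :=
  fun ω₂ lam β γ hω hl hβ T hT μ hμ hS hR D hD hsh => h ω₂ lam β γ hω hl hβ T hT μ hμ hS hR D hD.2 hsh

/-- Sanity: the crux implies the statement with `PreservesMeasure` dropped from the HYPOTHESES being…
no: dropping a hypothesis STRENGTHENS the statement; `PulseCalculusWithoutPreservesMeasure → PulseCalculus`.
[folklore] -/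
theorem pulseCalculus_of_withoutPreservesMeasure (h : PulseCalculusWithoutPreservesMeasure) :
    Theses.CoercivePulse.PulseCalculus :=
  fun ω₂ lam β γ hω hl hβ T hT μ hμ hS hR D _ hsh => h ω₂ lam β γ hω hl hβ T hT μ hμ hS hR D hsh

/-- **The carrier clause `∀ᵐ σ ∂μ, σ ∈ D.carrier` is load-bearing**: with only measure preservation
of the maps `φ_t` the statement is false. Witness: `ω₂ = lam = β = T = 1`, `γ = 0`, the shift-invariant
DLR state `μ` (`R`-invariant by uniqueness) and `pseudoDynamics`: the pulse is static (`M ≡ M(0)`) while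
`C(t) = -C₀` on `(0,∞)`, so clause (5) at `ν = 1` reads `-C₀ = ½∫₀^∞e^{-t}·0 dt = 0`, contradicting
`0 < C₀` (`static_sum_pos`). [folklore] -/
theorem pulseCalculus_false_without_carrierAE : ¬ PulseCalculusWithoutCarrierAE := by
  intro h
  obtain ⟨μ, hμ, hS, -⟩ :=
    OscillatorChain.exists_isChainGibbsMeasure_shiftInvariant_superstable_pinnedChain
      (ω₂ := 1) (lam := 1) (β := 1) (0 : ℝ) one_pos zero_le_one zero_le_one (T := 1) one_pos
  have hR : μ.map momentumReversalZ = μ :=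
    map_momentumReversalZ_eq 0 one_pos zero_le_one zero_le_one one_pos hμ hS
  have hR' : μ.map (fun σ : ChainConfig => fun x : ℤ => ((σ x).1, -(σ x).2)) = μ := hR
  set P := pinnedChain 1 1 1 0 with hP
  have hpos := static_sum_pos (ω₂ := 1) (lam := 1) (β := 1) 0 one_pos one_pos one_pos one_pos hμ hS
  set C₀ := ∑' x : ℤ, ∫ σ, P.bondCurrentZ σ 0 * P.bondCurrentZ σ x ∂μ with hC₀
  -- the site energy and the pulse of the pseudo-dynamics
  set hE : ChainConfig → ℤ → ℝ := fun (σ : ChainConfig) (x : ℤ) => (σ x).2 ^ 2 / 2 + P.U (σ x).1 +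
      (P.V ((σ (x + 1)).1 - (σ x).1) + P.V ((σ x).1 - (σ (x - 1)).1)) / 2 with hEdef
  set S : ℤ → ℝ → ℝ := fun (x : ℤ) (t : ℝ) =>
      ∫ σ, (hE σ 0 - ∫ σ', hE σ' 0 ∂μ) * (hE ((pseudoDynamics P).flow t σ) x - ∫ σ', hE σ' 0 ∂μ) ∂μ
    with hSdef
  obtain ⟨-, -, -, -, h5⟩ := h 1 1 1 0 one_pos one_pos one_pos 1 one_pos μ hμ hS hR' (pseudoDynamics P)
    (pseudo_measurePreserving P hR) (fun t => Eventually.of_forall (pseudo_shift_comm P t)) hE hEdef S hSdef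
  obtain ⟨-, hEq⟩ := h5 1 one_pos
  -- the pulse is static: `S x t = S x 0`
  have hEven : ∀ σ x, hE (momentumReversalZ σ) x = hE σ x := fun σ x => by
    simp only [hEdef, momentumReversalZ_apply, even_two.neg_pow]
  have hSt : ∀ (x : ℤ) (t : ℝ), S x t = ∫ σ, (hE σ 0 - ∫ σ', hE σ' 0 ∂μ) * (hE σ x - ∫ σ', hE σ' 0 ∂μ) ∂μ :=
    fun x t => pseudo_pulse_static P μ hEven _ x t
  have hdiff : ∀ t : ℝ, (∑' x : ℤ, (x : ℝ) ^ 2 * S x t) - (∑' x : ℤ, (x : ℝ) ^ 2 * S x 0) = 0 := by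
    intro t; simp only [hSt, sub_self]
  simp only [hdiff, mul_zero, integral_zero] at hEq
  -- the left-hand side is `-C₀`
  have hL : ∫ t in Set.Ioi (0:ℝ), Real.exp (-(1 * t)) * (pseudoDynamics P).currentCorrelation μ t = -C₀ := by
    have he : EqOn (fun t : ℝ => Real.exp (-(1 * t)) * (pseudoDynamics P).currentCorrelation μ t)
        (fun t : ℝ => Real.exp (-t) * (-C₀)) (Set.Ioi 0) := by
      intro t ht
      simp only [one_mul, pseudo_currentCorrelation_ne P μ (ne_of_gt (Set.mem_Ioi.mp ht)), hC₀]
    rw [setIntegral_congr_fun measurableSet_Ioi he, integral_mul_const, integral_exp_neg_Ioi_zero, one_mul]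
  rw [hL] at hEq
  linarith

/-- Corollary: dropping `D.PreservesMeasure μ` altogether is (a fortiori) false. [folklore] -/
theorem pulseCalculus_false_without_preservesMeasure : ¬ PulseCalculusWithoutPreservesMeasure :=
  fun h => pulseCalculus_false_without_carrierAE
    fun ω₂ lam β γ hω hl hβ T hT μ hμ hS hR D _ hsh => h ω₂ lam β γ hω hl hβ T hT μ hμ hS hR D hsh

/-- The same junk PASSES clause (4) (its `M` is constant) — so continuity of `M` does not detect a
non-Hamiltonian flow; only the Helfand identity (5b) does. [folklore] -/
theorem pseudo_M_continuous (μ : Measure ChainConfig) {h : ChainConfig → ℤ → ℝ}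
    (hh : ∀ σ x, h (momentumReversalZ σ) x = h σ x) (c : ℝ) :
    Continuous fun t : ℝ => ∑' x : ℤ, (x : ℝ) ^ 2 *
      ∫ σ, (h σ 0 - c) * (h ((pseudoDynamics P).flow t σ) x - c) ∂μ := by
  simp only [pseudo_pulse_static P μ hh]
  exact continuous_const

/-! ## §3 Idle hypotheses (derivable from the others) -/

/-- **`hRefl` is idle**: every shift-invariant DLR state of the pinned chain is momentum-reversal
invariant, in the literal form the crux uses. [folklore] -/
theorem reversal_derivable {ω₂ lam β : ℝ} (γ : ℝ) (hω : 0 < ω₂) (hl : 0 < lam) (hβ : 0 < β)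
    {T : ℝ} (hT : 0 < T) {μ : Measure ChainConfig}
    (hμ : (pinnedChain ω₂ lam β γ).IsChainGibbsMeasure T μ) (hS : IsShiftInvariant μ) :
    μ.map (fun σ : ChainConfig => fun x : ℤ => ((σ x).1, -(σ x).2)) = μ :=
  map_momentumReversalZ_eq γ hω hl.le hβ.le hT hμ hS

/-- **`0 < T` is idle**: a DLR state of the pinned chain exists only at positive temperature, so the
crux with the guard `0 < T` deleted is equivalent to the crux. [folklore] -/
theorem temp_pos_derivable {ω₂ lam β γ T : ℝ} (hω : 0 < ω₂) (hl : 0 < lam) (hβ : 0 < β)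
    {μ : Measure ChainConfig} (hμ : (pinnedChain ω₂ lam β γ).IsChainGibbsMeasure T μ) : 0 < T :=
  isChainGibbsMeasure_pinnedChain_temp_pos hω.le hl.le hβ.le hμ

/-- **The state is unique**: `∀ μ` in the crux ranges over one measure per temperature. [folklore] -/
theorem state_unique {ω₂ lam β : ℝ} (γ : ℝ) (hω : 0 < ω₂) (hl : 0 < lam) (hβ : 0 < β) {T : ℝ}
    (hT : 0 < T) {μ₁ μ₂ : Measure ChainConfig}
    (h₁ : (pinnedChain ω₂ lam β γ).IsChainGibbsMeasure T μ₁) (hS₁ : IsShiftInvariant μ₁)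
    (h₂ : (pinnedChain ω₂ lam β γ).IsChainGibbsMeasure T μ₂) (hS₂ : IsShiftInvariant μ₂) : μ₁ = μ₂ :=
  OscillatorChain.eq_of_isChainGibbsMeasure_of_isShiftInvariant_pinnedChain γ hω hl.le hβ.le hT h₁ hS₁ h₂ hS₂

/-! ## §4 Line `Sketch`: the pure real-analysis stub S3 and its summability hypothesis -/

/-- `Sig.stub_helfandLocal` of line `Sketch` with hypothesis (iii) `∀ t, Σ_x(1+x²)|S(x,t)| < ∞`
DROPPED (verbatim otherwise). [folklore] -/
def HelfandLocalWithoutSummableS : Prop :=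
  ∀ (S G : ℤ → ℝ → ℝ), (∀ x : ℤ, Continuous (G x)) →
    (∀ τ : ℝ, 0 ≤ τ → ∃ F : ℤ → ℝ, Summable (fun x : ℤ => (1 + (x : ℝ) ^ 2) * F x) ∧
      ∀ t : ℝ, |t| ≤ τ → ∀ x : ℤ, |G x t| ≤ F x) →
    (∀ (x : ℤ) (t : ℝ), 0 < t →
      S x t - S x 0 = ∫ u in Set.Ioc (0:ℝ) t, (t - u) * (G (x + 1) u - 2 * G x u + G (x - 1) u)) →
    ∀ t : ℝ, 0 < t →
      (∑' x : ℤ, (x : ℝ) ^ 2 * S x t) - (∑' x : ℤ, (x : ℝ) ^ 2 * S x 0) =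
        2 * ∫ u in Set.Ioc (0:ℝ) t, (t - u) * ∑' x : ℤ, G x u

/-- `x ↦ x² · c x` is not summable over `ℤ` as soon as `c x ≥ 1` off a finite set: here for
`1 ≤ c x` whenever `2 ≤ |x|`. [folklore] -/
theorem not_summable_sq_mul {c : ℤ → ℝ} (hc : ∀ x : ℤ, 2 ≤ |x| → 1 ≤ c x) :
    ¬ Summable (fun x : ℤ => (x : ℝ) ^ 2 * c x) := by
  intro hs
  have h0 := hs.tendsto_cofinite_zero
  have hev : ∀ᶠ x : ℤ in cofinite, (x : ℝ) ^ 2 * c x < 1 :=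
    h0.eventually (gt_mem_nhds one_pos)
  rw [Filter.eventually_cofinite] at hev
  -- every `x` with `2 ≤ |x|` violates the bound, and there are infinitely many
  have hsub : Set.range (fun n : ℕ => ((n : ℤ) + 2)) ⊆ {x : ℤ | ¬ (x : ℝ) ^ 2 * c x < 1} := by
    rintro x ⟨n, rfl⟩
    have h2 : (2 : ℤ) ≤ |((n : ℤ) + 2)| := by
      rw [abs_of_nonneg (by positivity)]; omega
    have h1 : (1 : ℝ) ≤ c ((n : ℤ) + 2) := hc _ h2
    have hx : (2 : ℝ) ≤ (((n : ℤ) + 2 : ℤ) : ℝ) := by push_cast; linarith [n.cast_nonneg (α := ℝ)]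
    simp only [Set.mem_setOf_eq, not_lt]
    nlinarith
  exact (Set.infinite_range_of_injective (fun a b h => by simpa using h)).mono hsub hev

/-- **Hypothesis (iii) of S3 is load-bearing (through junk `tsum`)**: without `Σ_x(1+x²)|S(·,t)| < ∞`
the local Helfand identity is false. Witness: `G(x,u) = δ₀(x)` (constant in time),
`S(x,t) = 1 + (t²/2)ΔG(x)` (so `S(x,0) = 1`): the per-site law and the `G`-majorant hold, both
`x²`-weighted sums DIVERGE at every `t` (junk value `0`), and at `t = 1` the identity would read
`0 - 0 = 2∫₀¹(1-u)·(Σ_xδ₀(x) = 1)du = 1`. [folklore] -/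
theorem helfandLocal_false_without_summableS : ¬ HelfandLocalWithoutSummableS := by
  intro h
  set g : ℤ → ℝ := fun x => if x = 0 then 1 else 0 with hg
  set G : ℤ → ℝ → ℝ := fun x _ => g x with hG
  set S : ℤ → ℝ → ℝ := fun x t => 1 + t ^ 2 / 2 * (g (x + 1) - 2 * g x + g (x - 1)) with hS
  have hcont : ∀ x : ℤ, Continuous (G x) := fun x => continuous_const
  have hsumF : Summable (fun x : ℤ => (1 + (x : ℝ) ^ 2) * g x) := by
    refine summable_of_ne_finset_zero (s := {0}) fun x hx => ?_
    rw [Finset.mem_singleton] at hx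
    simp [hg, hx]
  have hmaj : ∀ τ : ℝ, 0 ≤ τ → ∃ F : ℤ → ℝ, Summable (fun x : ℤ => (1 + (x : ℝ) ^ 2) * F x) ∧
      ∀ t : ℝ, |t| ≤ τ → ∀ x : ℤ, |G x t| ≤ F x := fun τ _ =>
    ⟨g, hsumF, fun t _ x => by
      simp only [hG, hg]
      split_ifs <;> simp⟩
  have hI : ∀ t : ℝ, 0 < t → ∫ u in Set.Ioc (0:ℝ) t, (t - u) = t ^ 2 / 2 := by
    intro t ht
    rw [← intervalIntegral.integral_of_le ht.le,
      intervalIntegral.integral_sub intervalIntegrable_const intervalIntegral.intervalIntegrable_id,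
      intervalIntegral.integral_const, integral_id]
    simp; ring
  have hper : ∀ (x : ℤ) (t : ℝ), 0 < t →
      S x t - S x 0 = ∫ u in Set.Ioc (0:ℝ) t, (t - u) * (G (x + 1) u - 2 * G x u + G (x - 1) u) := by
    intro x t ht
    simp only [hS, hG, integral_mul_const, hI t ht]
    ring
  have key := h S G hcont hmaj hper 1 one_pos
  -- both weighted sums diverge: junk `0`
  have hΔ : ∀ x : ℤ, 2 ≤ |x| → g (x + 1) - 2 * g x + g (x - 1) = 0 := by
    intro x hx
    have h1 : x + 1 ≠ 0 := by intro h; rw [show x = -1 by omega] at hx; norm_num at hx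
    have h2 : x ≠ 0 := by intro h; rw [h] at hx; norm_num at hx
    have h3 : x - 1 ≠ 0 := by intro h; rw [show x = 1 by omega] at hx; norm_num at hx
    simp [hg, h1, h2, h3]
  have hns1 : ¬ Summable (fun x : ℤ => (x : ℝ) ^ 2 * S x 1) :=
    not_summable_sq_mul fun x hx => by simp only [hS, hΔ x hx]; norm_num
  have hns0 : ¬ Summable (fun x : ℤ => (x : ℝ) ^ 2 * S x 0) :=
    not_summable_sq_mul fun x hx => by simp only [hS]; norm_num
  rw [tsum_eq_zero_of_not_summable hns1, tsum_eq_zero_of_not_summable hns0] at key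
  -- the right-hand side is `1`
  have htg : ∀ u : ℝ, (∑' x : ℤ, G x u) = 1 := fun u => by
    simp only [hG, hg]
    exact tsum_ite_eq 0 1
  simp only [htg, mul_one, hI 1 one_pos] at key
  norm_num at key

end Summit.AtomisticToContinuum.FouriersLaw.Cruxes.PulseCalculus.Disproof

end
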